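import Mathlib
import HarnessLib
import Literature.Analysis.SpecialFunctions.PeriodicArgComp
import Literature.MathematicalPhysics.QuantumLattice.AnisotropicSectors
import Literature.MathematicalPhysics.QuantumLattice.KohnLuttinger

/-!
# Route `KLProgramme`, crux K3 — ENGINE child `KLRegimeEngineV11` (stmt-HubbardSuperconductivity-19823), two-leg stubs: EXPLICIT
# ALL-ORDER DERIVATIVE BOUNDS OF THE POLAR ANGLE and of `2π`-periodic functions of it, `‖Dⁿ(g ∘ θ)(q)‖ ≤ n!·G·((n−1)!/r)ⁿ` for `‖q‖ ≥ r`

Cell gate-hubbard-kl, seat hubbard-kl-k3c3-p1 (g2; row «δμ-flow with `klAngularMean` constant piece»).  The G-extension of the two-leg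
slot (`klFrameExtG L μ f = symInterp L (k ↦ mean f + χ_flat(k)·(f(θ(k)) − mean f))`, BundleV6 §1) reads an ANGULAR profile `f` along the
polar angle `θ(k) = polarAngle` of the (centred) momentum; whatever carrier the two-leg sizes (E3a-G)/(E3a-MS) are finally certified on
(the interpolant, p2 g6's Δ-INTERP repair (R-I) `klFrameExtFn`, or a damped interpolant), the momentum-space derivatives of the SYMBOL
`p ↦ mean f + χ_flat(ε(p) − μ)·(f(θ(p̄)) − mean f)` are controlled by the angular derivatives of `f` through the chain rule with `θ`,
and that needs EXPLICIT bounds of `‖Dⁱθ‖` on the tube (`|p̄|² ≥ ε + 4 ≥ 2.85` on `klWindowC`).  The tree has the qualitative fact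
(`Literature.Analysis.SpecialFunctions.PeriodicArgComp`: a smooth `2π`-periodic function of `Complex.arg` is smooth off the origin,
the `2π`-jump across the negative axis being invisible to it).  This file makes it QUANTITATIVE, at every order:

* §1 `iteratedDeriv_succ_clog` / `norm_iteratedDeriv_succ_clog`: `log^{(l+1)}(z) = (−1)ˡ l! z^{−1−l}`, `‖log^{(l+1)}(z)‖ = l!/‖z‖^{l+1}`
  on the slit plane; `norm_iteratedFDeriv_im_le_of_contDiffAt` (real Fréchet derivatives of `Im F` against complex derivatives of a
  holomorphic `F`, by `restrictScalars`); **`norm_iteratedFDeriv_arg_le`**: `‖D^{l+1}_ℝ arg(z)‖ ≤ l!/‖z‖^{l+1}` on the slit plane, and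
  the opposite chart `norm_iteratedFDeriv_arg_neg_le` (`w ↦ arg(−w)`, for `−z` in the slit plane);
* §2 `norm_iteratedFDeriv_comp_le_of_isOpen` (Mathlib's `norm_iteratedFDerivWithin_comp_le` on an open chart) and
  **`norm_iteratedFDeriv_comp_arg_le`**: for `g` `C^N`, `2π`-periodic, `‖Dⁱg‖ ≤ G` (`i ≤ n`), `z ≠ 0`, `(i−1)!/‖z‖ⁱ ≤ Θⁱ`:
  `‖Dⁿ(g ∘ arg)(z)‖ ≤ n!·G·Θⁿ` (across the cut via `g(arg w) = g(arg(−w) + π)`); radius form `…_of_le_norm` with `Θ = (n−1)!/r`;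
* §3 transport to `Momentum = EuclideanSpace ℝ (Fin 2)` (`q ↦ q₀ + iq₁` is a real CLM of norm `≤ 1` evaluating to `momToComplex`):
  **`norm_iteratedFDeriv_comp_polarAngle_le`** / **`…_of_le_norm`**:
  `‖Dⁿ (q ↦ g(polarAngle q))(q)‖ ≤ n!·G·((n−1)!/r)ⁿ` for `‖q‖ ≥ r > 0`.

Proofs only (no definitions); nothing is asserted about the model.  References: Mathlib `Complex.contDiffAt_log`, `iter_deriv_inv`,
`norm_iteratedFDerivWithin_comp_le` (Faà di Bruno majorant); BGM 2006 [arXiv:cond-mat/0507686] §2.5 (2.45)–(2.46) (angular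
functions of the momentum), §2.3 (2.36)/(2.40) (angular derivatives of the two-leg local part).
-/

noncomputable section

namespace Summit.HubbardSuperconductivity.HubbardSuperconductivity.Theorems.KLRegimeSplit

set_option linter.dupNamespace false -- summit = problem name (single-conjunct summit), D-0017

open Real Finset Complex Filter Literature.MathematicalPhysics.QuantumLattice Literature.Analysis.SpecialFunctions
open scoped Topology

/-! ## §1 The complex logarithm and the argument: `‖D^{l+1} arg(z)‖ ≤ l!/|z|^{l+1}` off the origin, in both charts -/

/-- The iterated derivatives of the complex logarithm on the slit plane: `log^{(l+1)}(z) = (−1)^l · l! · z^{−1−l}`. -/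
theorem iteratedDeriv_succ_clog {z : ℂ} (hz : z ∈ slitPlane) (l : ℕ) :
    iteratedDeriv (l + 1) Complex.log z = (-1) ^ l * (l.factorial : ℂ) * z ^ (-1 - (l : ℤ)) := by
  rw [iteratedDeriv_succ']
  have hev : deriv Complex.log =ᶠ[𝓝 z] fun w => w⁻¹ := by
    filter_upwards [isOpen_slitPlane.mem_nhds hz] with w hw
    exact (Complex.hasDerivAt_log hw).deriv
  rw [Filter.EventuallyEq.iteratedDeriv_eq l hev, iteratedDeriv_eq_iterate, iter_deriv_inv]

/-- The norm of the iterated derivatives of the complex logarithm: `‖log^{(l+1)}(z)‖ = l!/‖z‖^{l+1}`. -/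
theorem norm_iteratedDeriv_succ_clog {z : ℂ} (hz : z ∈ slitPlane) (l : ℕ) :
    ‖iteratedDeriv (l + 1) Complex.log z‖ = (l.factorial : ℝ) / ‖z‖ ^ (l + 1) := by
  rw [iteratedDeriv_succ_clog hz l, norm_mul, norm_mul, norm_pow, norm_neg, norm_one, one_pow, one_mul,
    Complex.norm_natCast, norm_zpow, show (-1 - (l : ℤ)) = -((l + 1 : ℕ) : ℤ) by push_cast; ring, zpow_neg, zpow_natCast,
    div_eq_mul_inv]

/-- Real iterated Fréchet derivatives of the imaginary part of a holomorphic function are bounded by its complex derivatives: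
`‖Dˡ_ℝ (Im F)(z)‖ ≤ ‖F^{(l)}(z)‖`. -/
theorem norm_iteratedFDeriv_im_le_of_contDiffAt {F : ℂ → ℂ} {z : ℂ} {l : ℕ} (hF : ContDiffAt ℂ (l : WithTop ℕ∞) F z) :
    ‖iteratedFDeriv ℝ l (fun w => (F w).im) z‖ ≤ ‖iteratedDeriv l F z‖ := by
  have hFR : ContDiffAt ℝ (l : WithTop ℕ∞) F z := hF.restrict_scalars ℝ
  rw [show (fun w => (F w).im) = ⇑(Complex.imCLM : ℂ →L[ℝ] ℝ) ∘ F by funext w; simp,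
    ContinuousLinearMap.iteratedFDeriv_comp_left _ hFR le_rfl]
  refine (ContinuousLinearMap.norm_compContinuousMultilinearMap_le _ _).trans ?_
  rw [Complex.imCLM_norm, one_mul]
  have hres := hF.restrictScalars_iteratedFDeriv (𝕜 := ℝ)
  simp only [Function.comp_apply] at hres
  rw [← hres, ContinuousMultilinearMap.norm_restrictScalars, norm_iteratedFDeriv_eq_norm_iteratedDeriv]

/-- **`‖D^{l+1} arg(z)‖ ≤ l!/‖z‖^{l+1}` on the slit plane** (`arg = Im log`). -/
theorem norm_iteratedFDeriv_arg_le {z : ℂ} (hz : z ∈ slitPlane) (l : ℕ) :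
    ‖iteratedFDeriv ℝ (l + 1) Complex.arg z‖ ≤ (l.factorial : ℝ) / ‖z‖ ^ (l + 1) := by
  have harg : Complex.arg = fun w => (Complex.log w).im := by funext w; exact (Complex.log_im w).symm
  rw [harg]
  refine (norm_iteratedFDeriv_im_le_of_contDiffAt (Complex.contDiffAt_log hz)).trans ?_
  rw [norm_iteratedDeriv_succ_clog hz l]

/-- **The opposite chart**: `‖D^{l+1} (arg(−·))(z)‖ ≤ l!/‖z‖^{l+1}` whenever `−z` is in the slit plane. -/
theorem norm_iteratedFDeriv_arg_neg_le {z : ℂ} (hz : -z ∈ slitPlane) (l : ℕ) :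
    ‖iteratedFDeriv ℝ (l + 1) (fun w : ℂ => Complex.arg (-w)) z‖ ≤ (l.factorial : ℝ) / ‖z‖ ^ (l + 1) := by
  have harg : (fun w : ℂ => Complex.arg (-w)) = fun w => (Complex.log (-w)).im := by
    funext w; exact (Complex.log_im (-w)).symm
  rw [harg]
  have hF : ContDiffAt ℂ ((l + 1 : ℕ) : WithTop ℕ∞) (fun w : ℂ => Complex.log (-w)) z :=
    (Complex.contDiffAt_log hz).comp z contDiff_neg.contDiffAt
  refine (norm_iteratedFDeriv_im_le_of_contDiffAt hF).trans ?_
  rw [iteratedDeriv_comp_neg, norm_smul, norm_pow, norm_neg, norm_one, one_pow, one_mul,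
    norm_iteratedDeriv_succ_clog hz l, norm_neg]

/-! ## §2 Periodic functions of the argument: `‖Dⁿ(g ∘ arg)(z)‖ ≤ n!·G·Θⁿ` at every `z ≠ 0` -/

section Comp

variable {E : Type*} [NormedAddCommGroup E] [NormedSpace ℝ E] {g : ℝ → E} {N : WithTop ℕ∞}

/-- The composition bound on an open chart: if `θ` is `C^N` on an open set `U ∋ z` with `‖Dⁱθ(z)‖ ≤ Θⁱ` (`1 ≤ i ≤ n`) and
`‖Dⁱg‖ ≤ G` (`i ≤ n`) everywhere, then `‖Dⁿ(g∘θ)(z)‖ ≤ n!·G·Θⁿ`. -/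
theorem norm_iteratedFDeriv_comp_le_of_isOpen {F : Type*} [NormedAddCommGroup F] [NormedSpace ℝ F] {θ : F → ℝ} {U : Set F}
    (hU : IsOpen U) {z : F} (hz : z ∈ U) (hθ : ContDiffOn ℝ N θ U) (hg : ContDiff ℝ N g) {n : ℕ} (hn : (n : WithTop ℕ∞) ≤ N)
    {G Θ : ℝ} (hG : ∀ i ≤ n, ∀ t : ℝ, ‖iteratedFDeriv ℝ i g t‖ ≤ G)
    (hΘ : ∀ i, 1 ≤ i → i ≤ n → ‖iteratedFDeriv ℝ i θ z‖ ≤ Θ ^ i) :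
    ‖iteratedFDeriv ℝ n (fun w => g (θ w)) z‖ ≤ n.factorial * G * Θ ^ n := by
  rw [← iteratedFDerivWithin_of_isOpen n hU hz]
  have h := norm_iteratedFDerivWithin_comp_le (g := g) (f := θ) (s := U) (t := Set.univ) (x := z) hg.contDiffOn hθ hn
    uniqueDiffOn_univ hU.uniqueDiffOn (Set.mapsTo_univ _ _) hz (C := G) (D := Θ)
    (fun i hi => by rw [iteratedFDerivWithin_univ]; exact hG i hi _)
    (fun i hi1 hi2 => by rw [iteratedFDerivWithin_of_isOpen i hU hz]; exact hΘ i hi1 hi2)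
  exact h

/-- **Explicit derivative bounds of a periodic function of the argument**: for `g` `C^N`, `2π`-periodic with
`‖Dⁱg‖ ≤ G` (`i ≤ n`) and `z ≠ 0` with `(i−1)!/‖z‖ⁱ ≤ Θⁱ` (`1 ≤ i ≤ n`): `‖Dⁿ(g ∘ arg)(z)‖ ≤ n!·G·Θⁿ` — on the slit plane by
§1, across the cut through the chart `g(arg w) = g(arg(−w) + π)`. -/
theorem norm_iteratedFDeriv_comp_arg_le (hg : ContDiff ℝ N g) (hper : Function.Periodic g (2 * Real.pi)) {z : ℂ} (hz : z ≠ 0)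
    {n : ℕ} (hn : (n : WithTop ℕ∞) ≤ N) {G Θ : ℝ} (hG : ∀ i ≤ n, ∀ t : ℝ, ‖iteratedFDeriv ℝ i g t‖ ≤ G)
    (hΘ : ∀ i, 1 ≤ i → i ≤ n → ((i - 1).factorial : ℝ) / ‖z‖ ^ i ≤ Θ ^ i) :
    ‖iteratedFDeriv ℝ n (fun w => g (Complex.arg w)) z‖ ≤ n.factorial * G * Θ ^ n := by
  by_cases hs : z ∈ slitPlane
  · refine norm_iteratedFDeriv_comp_le_of_isOpen isOpen_slitPlane hs
      (fun w hw => (contDiffAt_arg_of_mem_slitPlane hw).contDiffWithinAt) hg hn hG fun i hi1 hi2 => ?_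
    obtain ⟨l, rfl⟩ : ∃ l, i = l + 1 := ⟨i - 1, by omega⟩
    refine (norm_iteratedFDeriv_arg_le hs l).trans ?_
    simpa using hΘ (l + 1) hi1 hi2
  · -- on the negative real axis: use the opposite chart
    rw [mem_slitPlane_iff, not_or, not_lt] at hs
    have hre : z.re < 0 := lt_of_le_of_ne hs.1 fun h => by
      apply hz; apply Complex.ext <;> simp [h, not_not.1 hs.2]
    rw [((arg_neg_add_pi_eventuallyEq hper hre).iteratedFDeriv ℝ n).eq_of_nhds]
    have hU : IsOpen {w : ℂ | w.re < 0} := isOpen_lt continuous_re continuous_const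
    have hch : ∀ w : ℂ, w.re < 0 → ContDiffAt ℝ N (fun w : ℂ => Complex.arg (-w)) w := fun w hw =>
      (contDiffAt_arg_of_mem_slitPlane (Or.inl (by simpa using hw))).comp w contDiff_neg.contDiffAt
    have hθ₂ : ContDiffOn ℝ N (fun w : ℂ => Complex.arg (-w) + Real.pi) {w : ℂ | w.re < 0} := fun w hw =>
      ((hch w hw).add contDiffAt_const).contDiffWithinAt
    refine norm_iteratedFDeriv_comp_le_of_isOpen hU hre hθ₂ hg hn hG fun i hi1 hi2 => ?_
    obtain ⟨l, rfl⟩ : ∃ l, i = l + 1 := ⟨i - 1, by omega⟩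
    have hneg : -z ∈ slitPlane := Or.inl (by simpa using hre)
    -- the constant `π` does not contribute to derivatives of positive order
    have h1 : iteratedFDeriv ℝ (l + 1) (fun w : ℂ => Complex.arg (-w) + Real.pi) z =
        iteratedFDeriv ℝ (l + 1) (fun w : ℂ => Complex.arg (-w)) z := by
      have hc : ContDiffAt ℝ ((l + 1 : ℕ) : WithTop ℕ∞) (fun _ : ℂ => (Real.pi : ℝ)) z := contDiffAt_const
      have ha : ContDiffAt ℝ ((l + 1 : ℕ) : WithTop ℕ∞) (fun w : ℂ => Complex.arg (-w)) z :=
        (hch z hre).of_le ((WithTop.coe_le_coe.mpr (by exact_mod_cast hi2)).trans hn)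
      rw [show (fun w : ℂ => Complex.arg (-w) + Real.pi) = (fun w : ℂ => Complex.arg (-w)) + fun _ => (Real.pi : ℝ) from rfl,
        iteratedFDeriv_add_apply ha hc, iteratedFDeriv_const_of_ne (by omega), Pi.zero_apply, add_zero]
    rw [h1]
    refine (norm_iteratedFDeriv_arg_neg_le hneg l).trans ?_
    simpa using hΘ (l + 1) hi1 hi2

/-- **Radius form**: for `‖z‖ ≥ r > 0`, `‖Dⁿ(g ∘ arg)(z)‖ ≤ n!·G·((n−1)!/r)ⁿ`. -/
theorem norm_iteratedFDeriv_comp_arg_le_of_le_norm (hg : ContDiff ℝ N g) (hper : Function.Periodic g (2 * Real.pi)) {z : ℂ}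
    {r : ℝ} (hr : 0 < r) (hrz : r ≤ ‖z‖) {n : ℕ} (hn : (n : WithTop ℕ∞) ≤ N) {G : ℝ}
    (hG : ∀ i ≤ n, ∀ t : ℝ, ‖iteratedFDeriv ℝ i g t‖ ≤ G) :
    ‖iteratedFDeriv ℝ n (fun w => g (Complex.arg w)) z‖ ≤ n.factorial * G * (((n - 1).factorial : ℝ) / r) ^ n := by
  have hz : z ≠ 0 := by
    intro h; rw [h, norm_zero] at hrz; exact absurd hrz (not_le.mpr hr)
  refine norm_iteratedFDeriv_comp_arg_le hg hper hz hn hG fun i hi1 hi2 => ?_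
  rw [div_pow]
  have hzpos : 0 < ‖z‖ := hr.trans_le hrz
  have hfac : ((i - 1).factorial : ℝ) ≤ ((n - 1).factorial : ℝ) ^ i := by
    have h1 : ((i - 1).factorial : ℝ) ≤ ((n - 1).factorial : ℝ) := by
      exact_mod_cast Nat.factorial_le (by omega)
    have h2 : (1 : ℝ) ≤ ((n - 1).factorial : ℝ) := by exact_mod_cast Nat.one_le_iff_ne_zero.mpr (Nat.factorial_ne_zero _)
    exact h1.trans (le_self_pow₀ h2 (by omega))
  have hri : r ^ i ≤ ‖z‖ ^ i := pow_le_pow_left₀ hr.le hrz i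
  exact div_le_div₀ (by positivity) hfac (by positivity) hri

end Comp

/-! ## §3 Transport to momentum space: periodic functions of `polarAngle` -/

section MomentumSpace

variable {E : Type*} [NormedAddCommGroup E] [NormedSpace ℝ E] {g : ℝ → E} {N : WithTop ℕ∞}

/-- The identification `q ↦ q₀ + i q₁` of `Momentum = EuclideanSpace ℝ (Fin 2)` with `ℂ` as a real continuous linear map of norm `≤ 1`,
evaluating to the tree's `momToComplex`. -/
theorem exists_momToComplexCLM :
    ∃ ι : Momentum →L[ℝ] ℂ, (∀ q : Momentum, ι q = momToComplex (WithLp.ofLp q)) ∧ ‖ι‖ ≤ 1 := by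
  let ι : Momentum →L[ℝ] ℂ := (Complex.equivRealProdCLM.symm : ℝ × ℝ →L[ℝ] ℂ).comp
    ((PiLp.proj 2 (fun _ : Fin 2 => ℝ) 0).prod (PiLp.proj 2 (fun _ : Fin 2 => ℝ) 1))
  have hι : ∀ q : Momentum, ι q = momToComplex (WithLp.ofLp q) := fun q => rfl
  refine ⟨ι, hι, ContinuousLinearMap.opNorm_le_bound _ zero_le_one fun q => ?_⟩
  rw [one_mul, hι]
  have h1 : ‖momToComplex (WithLp.ofLp q)‖ ^ 2 = ‖q‖ ^ 2 := by
    rw [Complex.sq_norm, Complex.normSq_apply, momToComplex_re, momToComplex_im, EuclideanSpace.norm_sq_eq, Fin.sum_univ_two,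
      Real.norm_eq_abs, Real.norm_eq_abs, sq_abs, sq_abs]
    ring
  nlinarith [norm_nonneg (momToComplex (WithLp.ofLp q)), norm_nonneg q]

/-- **Explicit derivative bounds of a periodic function of the polar angle on momentum space**: for `g` `C^N` and
`2π`-periodic with `‖Dⁱg‖ ≤ G` (`i ≤ n`), and `q ≠ 0` with `(i−1)!/‖q‖ⁱ ≤ Θⁱ` (`1 ≤ i ≤ n`):
`‖Dⁿ (q ↦ g(polarAngle q))(q)‖ ≤ n!·G·Θⁿ`. -/
theorem norm_iteratedFDeriv_comp_polarAngle_le (hg : ContDiff ℝ N g) (hper : Function.Periodic g (2 * Real.pi)) {q : Momentum}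
    (hq : q ≠ 0) {n : ℕ} (hn : (n : WithTop ℕ∞) ≤ N) {G Θ : ℝ} (hG : ∀ i ≤ n, ∀ t : ℝ, ‖iteratedFDeriv ℝ i g t‖ ≤ G)
    (hΘ : ∀ i, 1 ≤ i → i ≤ n → ((i - 1).factorial : ℝ) / ‖q‖ ^ i ≤ Θ ^ i) :
    ‖iteratedFDeriv ℝ n (fun q : Momentum => g (polarAngle (WithLp.ofLp q))) q‖ ≤ n.factorial * G * Θ ^ n := by
  obtain ⟨ι, hι, hιn⟩ := exists_momToComplexCLM
  have hnormq : ‖ι q‖ = ‖q‖ := by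
    rw [hι]
    have h1 : ‖momToComplex (WithLp.ofLp q)‖ ^ 2 = ‖q‖ ^ 2 := by
      rw [Complex.sq_norm, Complex.normSq_apply, momToComplex_re, momToComplex_im, EuclideanSpace.norm_sq_eq, Fin.sum_univ_two,
        Real.norm_eq_abs, Real.norm_eq_abs, sq_abs, sq_abs]
      ring
    nlinarith [norm_nonneg (momToComplex (WithLp.ofLp q)), norm_nonneg q]
  have hz : ι q ≠ 0 := by
    intro h; apply hq
    have : ‖q‖ = 0 := by rw [← hnormq, h, norm_zero]
    exact norm_eq_zero.mp this
  have hfun : (fun q : Momentum => g (polarAngle (WithLp.ofLp q))) = (fun w => g (Complex.arg w)) ∘ ι := by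
    funext q'; simp [polarAngle, hι]
  -- work within the open sets `{w ≠ 0}` and its preimage
  set s : Set ℂ := {w | w ≠ 0} with hs
  have hso : IsOpen s := isOpen_ne
  have hpo : IsOpen (ι ⁻¹' s) := hso.preimage ι.continuous
  have hqs : q ∈ ι ⁻¹' s := hz
  rw [hfun, ← iteratedFDerivWithin_of_isOpen n hpo hqs,
    ContinuousLinearMap.iteratedFDerivWithin_comp_right ι (hg.contDiffOn_comp_arg hper) hso.uniqueDiffOn hpo.uniqueDiffOn hz hn,
    iteratedFDerivWithin_of_isOpen n hso hz]
  refine (ContinuousMultilinearMap.norm_compContinuousLinearMap_le _ _).trans ?_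
  have hprod : ∏ _i : Fin n, ‖ι‖ ≤ 1 := by
    rw [Finset.prod_const, Finset.card_univ, Fintype.card_fin]
    exact pow_le_one₀ (norm_nonneg _) hιn
  have hmain := norm_iteratedFDeriv_comp_arg_le hg hper hz hn hG (Θ := Θ) (fun i hi1 hi2 => by rw [hnormq]; exact hΘ i hi1 hi2)
  have h0 : 0 ≤ ‖iteratedFDeriv ℝ n (fun w => g (Complex.arg w)) (ι q)‖ := norm_nonneg _
  calc ‖iteratedFDeriv ℝ n (fun w => g (Complex.arg w)) (ι q)‖ * ∏ _i : Fin n, ‖ι‖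
      ≤ ‖iteratedFDeriv ℝ n (fun w => g (Complex.arg w)) (ι q)‖ * 1 :=
        mul_le_mul_of_nonneg_left hprod h0
    _ ≤ n.factorial * G * Θ ^ n := by rw [mul_one]; exact hmain

/-- **Radius form on momentum space**: for `‖q‖ ≥ r > 0`, `‖Dⁿ (q ↦ g(polarAngle q))(q)‖ ≤ n!·G·((n−1)!/r)ⁿ`. -/
theorem norm_iteratedFDeriv_comp_polarAngle_le_of_le_norm (hg : ContDiff ℝ N g) (hper : Function.Periodic g (2 * Real.pi))
    {q : Momentum} {r : ℝ} (hr : 0 < r) (hrq : r ≤ ‖q‖) {n : ℕ} (hn : (n : WithTop ℕ∞) ≤ N) {G : ℝ}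
    (hG : ∀ i ≤ n, ∀ t : ℝ, ‖iteratedFDeriv ℝ i g t‖ ≤ G) :
    ‖iteratedFDeriv ℝ n (fun q : Momentum => g (polarAngle (WithLp.ofLp q))) q‖ ≤
      n.factorial * G * (((n - 1).factorial : ℝ) / r) ^ n := by
  have hq : q ≠ 0 := by
    intro h; rw [h, norm_zero] at hrq; exact absurd hrq (not_le.mpr hr)
  refine norm_iteratedFDeriv_comp_polarAngle_le hg hper hq hn hG fun i hi1 hi2 => ?_
  rw [div_pow]
  have hfac : ((i - 1).factorial : ℝ) ≤ ((n - 1).factorial : ℝ) ^ i := by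
    have h1 : ((i - 1).factorial : ℝ) ≤ ((n - 1).factorial : ℝ) := by
      exact_mod_cast Nat.factorial_le (by omega)
    have h2 : (1 : ℝ) ≤ ((n - 1).factorial : ℝ) := by exact_mod_cast Nat.one_le_iff_ne_zero.mpr (Nat.factorial_ne_zero _)
    exact h1.trans (le_self_pow₀ h2 (by omega))
  exact div_le_div₀ (by positivity) hfac (by positivity) (pow_le_pow_left₀ hr.le hrq i)

end MomentumSpace

end Summit.HubbardSuperconductivity.HubbardSuperconductivity.Theorems.KLRegimeSplit

end
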